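import Mathlib
import HarnessLib
import Summits.BirchSwinnertonDyer.BirchSwinnertonDyer.Theses.ManinLocalTwoThree
import Literature.NumberTheory.EllipticCurves.ManinConstantSemistablePrimewise
import Literature.NumberTheory.EllipticCurves.ManinConstantClassCertificateTwistGamma0Proofs
import Literature.NumberTheory.EllipticCurves.ManinConstantClassCertificateTwist
import Literature.NumberTheory.EllipticCurves.ManinConstantClassCertificate
import Literature.NumberTheory.EllipticCurves.IsogenyConductorModularityProofs
import Literature.NumberTheory.EllipticCurves.ModularParametrizationTrustBaseProofs
import Literature.NumberTheory.EllipticCurves.ModularParametrizationDegreeHoldsProofs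
import Literature.NumberTheory.EllipticCurves.IsogenyIdProofs
import Literature.NumberTheory.EllipticCurves.IsogenyDualProofs
import Literature.NumberTheory.EllipticCurves.IsogenyCompProofs
import Literature.NumberTheory.EllipticCurves.IsogenyVariableChangeProofs
import Literature.NumberTheory.EllipticCurves.IsogenyQuadraticTwistProofs
import Literature.NumberTheory.EllipticCurves.SzpiroLocalDataProofs
import Literature.NumberTheory.EllipticCurves.SzpiroOfAbcProofs
import Literature.NumberTheory.EllipticCurves.GlobalMinimalModelProofs
import Summits.BirchSwinnertonDyer.Rank1Residual.Additive.GordTwistMinimalModel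
import Summits.BirchSwinnertonDyer.Rank1Residual.ManinAdditive.TwistOrbitDegreeIdentity

/-!
# Route `ManinLocalTwoThree`, crux C2 `ManinOddAtFour` (stmt-BirchSwinnertonDyer-22967): the
# ODD-UNTWISTING REDUCTION of the twist-minimal core `stub_twistMinimalAtTwo`

After the lines `dyadic-twist` (C2) closed the twist-covered half, the open content of C2 is the
registered stub `stub_twistMinimalAtTwo`: Manin's conjecture at `2` for the optimal curves with
`4 ∣ N` whose class is NOT a `χ₋₄ / χ_{±8}`-twist of a class semistable at `2`. This file shrinks that
locus further, kernel-checked: **`stub_twistMinimalAtTwo` follows from its restriction to the classes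
that ALSO admit no odd semistable untwist** — no odd prime `q` with `q² ∣ N` and `W ∼ W' ⊗ ℚ(√q*)`,
`q² ∤ N(W')` (at `q ≥ 5`: no odd prime of Kodaira type `I₀*`/`Iₙ*`; row (D) of the line prover p1's
repair census `C2-twistMinimalAtTwo-census-p1.md`, there left as «a REDUCTION, not a closure»).

Mechanism (§2, `maninLocalTwoThree_not_dvd_maninConstant_of_oddUntwist`): the tree's `Γ₀` twist step
`maninConstant_dvd_of_charTwist_gamma0` (Stevens 1989 (5.2) at odd `q`, PROVED as
`stevens1989_neronLattice_quadraticTwist_oddPrime_holds`, + the `Γ₀` twisting theorem) gives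
`c(D) ∣ c(D')` for the lattice-optimal datum `D` of `W` and the optimal datum `D'` of the untwisted
class `𝒜'`; so ANY prime `p ∤ c` on the class `𝒜'` transports to `p ∤ c(D)` (the tree's certificate
`not_dvd_maninConstant_of_isTwistOfSemistableAt_gamma0` is the case `p = q`, where Česnavičius 2018
supplies `q ∤ c(D')`). The side conditions `N(W') ∣ N(W)` and additivity of `W` at `q` are discharged
here (§1: isogeny invariance of the conductor granted modularity; `χ_{q*}` unramified off `q`).
Induction (§3, `maninLocalTwoThree_twistMinimalAtTwo_of_oddUntwistMinimal`): strong induction on the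
level; the partner class `𝒜'` has SMALLER conductor (`v_q` drops), is again additive at `2` with
`4 ∣ N'` (`χ_{q*}` is unramified at `2`), and is again twist-minimal at `2` (a dyadic semistable
partner `V` of `𝒜'` would give the dyadic semistable partner `V ⊗ χ_{q*}` of `𝒜`).
Nothing here proves BSD or Manin's conjecture at `2`: the residual locus (additive at `2`, dyadically
twist-minimal, no odd semistable untwist) is infinite and open. Seat bsd-line-manin23-p2 (prover).

References: [Stevens1989] Lemmas (5.2), (5.4); [Cesnavicius2018] Thm. 1.2; [SilvermanATAEC1994] IV.9.4,
Exercise 4.40; [DiamondShurman2005] Thm. 8.8.1.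
-/

set_option autoImplicit false
set_option linter.dupNamespace false

noncomputable section

open scoped Classical NumberField

namespace Summit.BirchSwinnertonDyer.BirchSwinnertonDyer.Theorems

open WeierstrassCurve IsDedekindDomain IsDedekindDomain.HeightOneSpectrum Rat.HeightOneSpectrum
  Literature.NumberTheory.Automorphic
  Literature.NumberTheory.EllipticCurves Literature.NumberTheory.EllipticCurves.ModularForms

/-! ## §1 Conductor bookkeeping of an odd twist pair `W ∼ W' ⊗ ℚ(√q*)` -/

/-- **Off `q`, `W ∼ W' ⊗ ℚ(√q*)` have the same conductor exponents** (granted modularity): the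
conductor is an isogeny invariant (`conductorNorm_eq_of_isIsogenous_of_modularity`) and the twist by
`q* ≡ 1 (mod 4)` is unramified at every place `v ∤ q`
(`Additive.conductorExponent_eq_of_twist_pStar_of_ne`). [cite: SilvermanATAEC1994, IV.9.4 and Exercise 4.40] -/
theorem maninLocalTwoThree_conductorExponent_eq_of_isIsogenous_twist_pStar
    (hnf : exists_isNewformOf) {q : ℕ} [Fact q.Prime] (hq2 : q ≠ 2)
    {W : WeierstrassCurve ℚ} [W.IsElliptic] {W' : WeierstrassCurve ℚ} [W'.IsElliptic]
    (htw : IsIsogenous W (W'.quadraticTwist (((-1 : ℤ) ^ (q / 2) * q : ℤ) : ℚ)))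
    (v : HeightOneSpectrum ℤ) (hv : natGenerator v ≠ q) :
    W.conductorExponent v = W'.conductorExponent v := by
  have hqp : q.Prime := Fact.out
  have hd0 : ((((-1 : ℤ) ^ (q / 2) * q : ℤ)) : ℚ) ≠ 0 := by
    push_cast
    exact mul_ne_zero (pow_ne_zero _ (by norm_num)) (by exact_mod_cast hqp.ne_zero)
  haveI : (W'.quadraticTwist (((-1 : ℤ) ^ (q / 2) * q : ℤ) : ℚ)).IsElliptic :=
    W'.isElliptic_quadraticTwist hd0
  have hWV : W.conductorNorm ℤ = (W'.quadraticTwist (((-1 : ℤ) ^ (q / 2) * q : ℤ) : ℚ)).conductorNorm ℤ :=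
    conductorNorm_eq_of_isIsogenous_of_modularity
      (nonempty_modularParametrizationData_of_exists_isNewformOf hnf
        IsNewformOf.exists_maninConstant_ne_zero_holds) _ _ htw
  have hC : (1 : VariableChange ℚ) • W'.quadraticTwist ((-1 : ℚ) ^ (q / 2) * q) =
      W'.quadraticTwist (((-1 : ℤ) ^ (q / 2) * q : ℤ) : ℚ) := by
    rw [one_smul]; push_cast; rfl
  have hVW' : (W'.quadraticTwist (((-1 : ℤ) ^ (q / 2) * q : ℤ) : ℚ)).conductorExponent v =
      W'.conductorExponent v :=
    Summit.BirchSwinnertonDyer.Rank1Residual.Additive.conductorExponent_eq_of_twist_pStar_of_ne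
      q hq2 W' _ 1 hC v hv
  have hWV' : W.conductorExponent v =
      (W'.quadraticTwist (((-1 : ℤ) ^ (q / 2) * q : ℤ) : ℚ)).conductorExponent v := by
    have h1 := factorization_conductorNorm_holds W v
    have h2 := factorization_conductorNorm_holds (W'.quadraticTwist (((-1 : ℤ) ^ (q / 2) * q : ℤ) : ℚ)) v
    rw [← h1, ← h2, hWV]
  rw [hWV', hVW']

/-- **`N(W') ∣ N(W)` for `W ∼ W' ⊗ ℚ(√q*)`, `q² ∤ N(W')`, `W` additive at `q`** (granted modularity):
off `q` the exponents agree (above); at `q`, `f_q(W') ≤ 1 < 2 ≤ f_q(W)`.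
[cite: SilvermanATAEC1994, IV.9.4 and Exercise 4.40] -/
theorem maninLocalTwoThree_conductorNorm_dvd_of_isIsogenous_twist_pStar
    (hnf : exists_isNewformOf) {q : ℕ} [Fact q.Prime] (hq2 : q ≠ 2)
    {W : WeierstrassCurve ℚ} [W.IsElliptic] {W' : WeierstrassCurve ℚ} [W'.IsElliptic]
    (htw : IsIsogenous W (W'.quadraticTwist (((-1 : ℤ) ^ (q / 2) * q : ℤ) : ℚ)))
    (hqN' : ¬ q ^ 2 ∣ W'.conductorNorm ℤ)
    (hadd : ¬ W.HasGoodReductionAtPrime q ∧ ¬ W.HasMultiplicativeReductionAtPrime q) :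
    W'.conductorNorm ℤ ∣ W.conductorNorm ℤ := by
  have hqp : q.Prime := Fact.out
  have hqN : q ^ 2 ∣ W.conductorNorm ℤ := sq_dvd_conductorNorm_of_not_good_of_not_mult hadd
  have hB : W.conductorNorm ℤ ≠ 0 := (conductorNorm_pos_holds W).ne'
  refine conductorNorm_dvd_of_forall_conductorExponent_le W' hB fun p ↦ ?_
  rw [factorization_conductorNorm_primesEquiv_symm W p]
  by_cases hpq : (p : ℕ) = q
  · have h1 : W'.conductorExponent ((primesEquiv (R := ℤ)).symm p) ≤ 1 := by
      rw [← factorization_conductorNorm_primesEquiv_symm W' p, hpq]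
      by_contra h
      push Not at h
      exact hqN' ((hqp.pow_dvd_iff_le_factorization (conductorNorm_pos_holds W').ne').mpr h)
    have h2 : 2 ≤ W.conductorExponent ((primesEquiv (R := ℤ)).symm p) := by
      rw [← factorization_conductorNorm_primesEquiv_symm W p, hpq]
      exact (hqp.pow_dvd_iff_le_factorization hB).mp hqN
    omega
  · have hgen : natGenerator ((primesEquiv (R := ℤ)).symm p) = p :=
      natGenerator_primesEquiv_symm p.2
    rw [maninLocalTwoThree_conductorExponent_eq_of_isIsogenous_twist_pStar hnf hq2 htw _
      (by rw [hgen]; exact hpq)]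

/-! ## §2 Transport of `p ∤ c` down an odd semistable untwist -/

/-- **Transport of `p ∤ c` along an odd semistable untwist (any prime `p`)**, granted only
modularity `hnf`: let `W` be globally minimal with a lattice-optimal `X₀(N)`-datum `D`, `q` an odd
prime with `q² ∣ N`, and `W ∼ W' ⊗ ℚ(√q*)` with `W'` globally minimal, `q² ∤ N(W')`. If EVERY
lattice-optimal datum of every globally minimal curve isogenous to `W'` has Manin constant prime to
`p`, then `p ∤ D.maninConstant`. Proof: the optimal `X₀(N(W'))`-datum `D'` of the class of `W'`
(`exists_optimal_modularParametrizationData_of_isNewformOf'`) satisfies `c(D) ∣ c(D')` by the tree's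
`Γ₀` twist step `maninConstant_dvd_of_charTwist_gamma0` — inputs: Stevens (5.2) at odd `q`
(`stevens1989_neronLattice_quadraticTwist_oddPrime_holds`), the twist relation
`aₙ(f_D) = (n/q) aₙ(f_{D'})` (isogeny invariance of `L`, `LFunction_quadraticTwist_pStar_apply` off
`q`, additivity of `W` at `q` on the multiples of `q`), `N(W') ∣ N` (§1), `q² ∣ N`.
[cite: Stevens1989, Lemmas (5.2), (5.4)] [cite: DiamondShurman2005, Thm. 8.8.1] -/
theorem maninLocalTwoThree_not_dvd_maninConstant_of_oddUntwist
    (hnf : exists_isNewformOf) {q : ℕ} [Fact q.Prime] (hq2 : q ≠ 2)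
    {W : WeierstrassCurve ℚ} [W.IsElliptic] [W.IsGloballyMinimal] {N : ℕ} [NeZero N]
    (D : ModularParametrizationData W N)
    (hopt : ∀ z ∈ D.L.lattice, ∃ w ∈ periodLattice D.f, z = D.c * w) (hqN : q ^ 2 ∣ N)
    {W' : WeierstrassCurve ℚ} [W'.IsElliptic] [W'.IsGloballyMinimal]
    (htw : IsIsogenous W (W'.quadraticTwist (((-1 : ℤ) ^ (q / 2) * q : ℤ) : ℚ)))
    (hqN' : ¬ q ^ 2 ∣ W'.conductorNorm ℤ) {p : ℤ}
    (hp : ∀ (W₁ : WeierstrassCurve ℚ) [W₁.IsElliptic] [W₁.IsGloballyMinimal] {N₁ : ℕ} [NeZero N₁]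
      (D₁ : ModularParametrizationData W₁ N₁), IsIsogenous W' W₁ →
      (∀ z ∈ D₁.L.lattice, ∃ w ∈ periodLattice D₁.f, z = D₁.c * w) → ¬ p ∣ D₁.maninConstant) :
    ¬ p ∣ D.maninConstant := by
  have hqp : q.Prime := Fact.out
  have hd0 : ((((-1 : ℤ) ^ (q / 2) * q : ℤ)) : ℚ) ≠ 0 := by
    push_cast
    exact mul_ne_zero (pow_ne_zero _ (by norm_num)) (by exact_mod_cast hqp.ne_zero)
  haveI : (W'.quadraticTwist (((-1 : ℤ) ^ (q / 2) * q : ℤ) : ℚ)).IsElliptic :=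
    W'.isElliptic_quadraticTwist hd0
  -- the level is the conductor; `W` is additive at `q`; `N(W') ∣ N(W)`
  have hN : N = W.conductorNorm ℤ :=
    IsNewformOf.level_eq_conductorNorm_of_exists_isNewformOf hnf D.isNewformOf
  have hqNW : q ^ 2 ∣ W.conductorNorm ℤ := hN ▸ hqN
  have hadd : ¬ W.HasGoodReductionAtPrime q ∧ ¬ W.HasMultiplicativeReductionAtPrime q :=
    Summit.BirchSwinnertonDyer.Rank1Residual.ManinAdditive.not_good_and_not_mult_of_sq_dvd_conductorNorm
      W hqNW
  have hN'N : W'.conductorNorm ℤ ∣ W.conductorNorm ℤ :=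
    maninLocalTwoThree_conductorNorm_dvd_of_isIsogenous_twist_pStar hnf hq2 htw hqN' hadd
  haveI : NeZero (W'.conductorNorm ℤ) := ⟨(conductorNorm_pos_holds W').ne'⟩
  -- the optimal `X₀`-datum `D'` of the class of `W'`, on a globally minimal `W₁' ∼ W'`
  obtain ⟨f', hf'⟩ := hnf W'
  obtain ⟨W₁', hE₁', hM₁', D', hD'f, hiso', hmin⟩ :=
    exists_optimal_modularParametrizationData_of_isNewformOf' (W'.conductorNorm ℤ) W' rfl hf'
  haveI := hE₁'
  haveI := hM₁'
  have hopt' : ∀ z ∈ D'.L.lattice, ∃ w ∈ periodLattice D'.f, z = D'.c * w :=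
    D'.latticeEq_of_forall_modularDegree_le fun W₂ _ D₂ h2 ↦ hmin W₂ D₂ (h2.trans hD'f)
  -- `W₁'` is semistable at `q`
  have hN'₁ : W'.conductorNorm ℤ = W₁'.conductorNorm ℤ :=
    IsNewformOf.level_eq_conductorNorm_of_exists_isNewformOf hnf D'.isNewformOf
  have hsemi : W₁'.HasGoodReductionAtPrime q ∨ W₁'.HasMultiplicativeReductionAtPrime q :=
    hasGoodReductionAtPrime_or_hasMultiplicativeReductionAtPrime_of_not_sq_dvd_conductorNorm
      (by rw [← hN'₁]; exact hqN')
  -- a minimal model `C` of `W₁' ⊗ χ_{q*}` and a Néron pair of it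
  haveI : (W₁'.quadraticTwist (((-1 : ℤ) ^ (q / 2) * q : ℤ) : ℚ)).IsElliptic :=
    W₁'.isElliptic_quadraticTwist hd0
  obtain ⟨vC, hvC⟩ := hasGlobalMinimalModel_rat_holds
    (W₁'.quadraticTwist (((-1 : ℤ) ^ (q / 2) * q : ℤ) : ℚ))
  haveI := hvC
  haveI : ((vC • W₁'.quadraticTwist (((-1 : ℤ) ^ (q / 2) * q : ℤ) : ℚ)).baseChange ℂ).IsElliptic := by
    rw [WeierstrassCurve.baseChange]; infer_instance
  obtain ⟨LC, hC⟩ := exists_isNeronLatticeOf_holds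
    ((vC • W₁'.quadraticTwist (((-1 : ℤ) ^ (q / 2) * q : ℤ) : ℚ)).baseChange ℂ)
  -- the Legendre character, Gauss's evaluation, Stevens (5.2)
  have hχq := isQuadratic_quadraticChar_ringHomComp q
  have hχp := isPrimitive_quadraticChar_ringHomComp q hq2
  have hG := gaussSum_quadraticChar_ringHomComp_sq q hq2
  have hLC : ∀ z : ℂ, z ∈ LC.lattice ↔
      gaussSum ((quadraticChar (ZMod q)).ringHomComp (Int.castRingHom ℂ))
        (ZMod.stdAddChar (N := q)) * z ∈ D'.L.lattice :=
    stevens1989_neronLattice_quadraticTwist_oddPrime_holds W₁' D'.L D'.isNeronLattice q hq2 hsemi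
      _ ⟨vC, rfl⟩ LC hC _ hG
  -- the newform of `W` is the `(·/q)`-twist of that of `W'`
  have hLtw : W.LFunction =
      (W'.quadraticTwist (((-1 : ℤ) ^ (q / 2) * q : ℤ) : ℚ)).LFunction :=
    LFunction_eq_of_isIsogenous_holds _ _ htw
  have hf : ∀ n : ℕ, cuspCoeff D.f n =
      (quadraticChar (ZMod q)).ringHomComp (Int.castRingHom ℂ) n * cuspCoeff D'.f n := by
    intro n
    rw [D.isNewformOf.2 n, hD'f, hf'.2 n, quadraticChar_ringHomComp_apply_natCast q n]
    by_cases hqn : q ∣ n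
    · have h0 : W.LFunction n = 0 :=
        W.LFunction_apply_eq_zero_of_not_good_of_not_mult q hadd.1 hadd.2 hqn
      have hl : legendreSym q n = 0 := (legendreSym.eq_zero_iff q n).mpr (by
        rw [ZMod.intCast_zmod_eq_zero_iff_dvd]
        exact_mod_cast hqn)
      rw [h0, hl]
      simp
    · have hLn' : W.LFunction n =
          (W'.quadraticTwist (((-1 : ℤ) ^ (q / 2) * q : ℤ) : ℚ)).LFunction n := by rw [hLtw]
      rw [hLn', W'.LFunction_quadraticTwist_pStar_apply hq2 hqn]
      have hne : ((n : ℤ) : ZMod q) ≠ 0 := by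
        rw [Int.cast_natCast, Ne, ZMod.natCast_eq_zero_iff]
        exact hqn
      push_cast
      rcases legendreSym.eq_one_or_neg_one q hne with h1 | h1
      · rw [show (legendreSym q (n : ℤ)) = legendreSym q n from rfl, h1]
      · rw [show (legendreSym q (n : ℤ)) = legendreSym q n from rfl, h1]
  -- the `Γ₀` twist step: `c(D) ∣ c(D')`
  have hNlv : W'.conductorNorm ℤ ∣ N := by rw [hN]; exact hN'N
  have hdvd : D.c ∣ D'.c :=
    maninConstant_dvd_of_charTwist_gamma0 D' D hopt hχq hχp hNlv hqN hf hC hLC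
  have hD' : ¬ p ∣ D'.maninConstant := hp W₁' D' hiso' hopt'
  exact fun h ↦ hD' (h.trans hdvd)

/-! ## §3 The reduction: `stub_twistMinimalAtTwo` ⟸ its oddly-twist-minimal core -/

/-- **ODD-UNTWISTING REDUCTION of the C2 core.** The registered stub `stub_twistMinimalAtTwo` of crux
`ManinOddAtFour` (stmt-BirchSwinnertonDyer-22967; verbatim as the conclusion) FOLLOWS from its
restriction to the classes that, besides being dyadically twist-minimal, admit NO odd semistable
untwist: no odd prime `q` with `q² ∣ N` and `W ∼ W' ⊗ ℚ(√q*)`, `W'` globally minimal, `q² ∤ N(W')`.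
Strong induction on the level `N`: an odd untwist partner class has its optimal curve `W₁` at level
`N(W') < N` (§1: `N(W') ∣ N(W)`, `v_q` drops), still `4 ∣ N(W')` (`f₂` is unchanged, §1), still
dyadically twist-minimal (a dyadic semistable partner `V` of `W₁` yields the dyadic semistable partner
`V ⊗ χ_{q*}` of `W`: `IsIsogenous.quadraticTwist`, `quadraticTwist_quadraticTwist`, and
`f₂(V ⊗ χ_{q*}) = f₂(V) ≤ 1`), so the induction hypothesis gives `2 ∤ c` on the partner class and §2
transports it to `W`. [cite: Stevens1989, Lemmas (5.2), (5.4)] [cite: SilvermanATAEC1994, IV.9.4] -/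
theorem maninLocalTwoThree_twistMinimalAtTwo_of_oddUntwistMinimal
    (H : Literature.NumberTheory.EllipticCurves.ModularForms.mazur_not_dvd_maninConstant_of_odd →
      Literature.NumberTheory.EllipticCurves.ModularForms.abbesUllmo_not_dvd_maninConstant_of_not_dvd_level →
      Literature.NumberTheory.EllipticCurves.ModularForms.cesnavicius_not_two_dvd_maninConstant_of_two_dvd_level →
      Literature.NumberTheory.EllipticCurves.ModularForms.exists_isNewformOf →
      ∀ (W : WeierstrassCurve ℚ) [W.IsElliptic] [W.IsGloballyMinimal] {N : ℕ} [NeZero N]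
        (D : ModularParametrizationData W N),
        (∀ z ∈ D.L.lattice, ∃ w ∈ periodLattice D.f, z = D.c * w) → 2 ^ 2 ∣ N →
        ¬ (∃ (W' : WeierstrassCurve ℚ) (d : ℤ), W'.IsElliptic ∧ W'.IsGloballyMinimal ∧
          (d = -1 ∨ d = 2 ∨ d = -2) ∧ IsIsogenous W (W'.quadraticTwist (d : ℚ)) ∧
          ¬ 2 ^ 2 ∣ W'.conductorNorm ℤ) →
        ¬ (∃ (W' : WeierstrassCurve ℚ) (q : ℕ), W'.IsElliptic ∧ W'.IsGloballyMinimal ∧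
          q.Prime ∧ q ≠ 2 ∧ q ^ 2 ∣ N ∧
          IsIsogenous W (W'.quadraticTwist (((-1 : ℤ) ^ (q / 2) * q : ℤ) : ℚ)) ∧
          ¬ q ^ 2 ∣ W'.conductorNorm ℤ) →
        ¬ (2 : ℤ) ∣ D.maninConstant) :
    Literature.NumberTheory.EllipticCurves.ModularForms.mazur_not_dvd_maninConstant_of_odd →
    Literature.NumberTheory.EllipticCurves.ModularForms.abbesUllmo_not_dvd_maninConstant_of_not_dvd_level →
    Literature.NumberTheory.EllipticCurves.ModularForms.cesnavicius_not_two_dvd_maninConstant_of_two_dvd_level →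
    Literature.NumberTheory.EllipticCurves.ModularForms.exists_isNewformOf →
    ∀ (W : WeierstrassCurve ℚ) [W.IsElliptic] [W.IsGloballyMinimal] {N : ℕ} [NeZero N]
      (D : ModularParametrizationData W N),
      (∀ z ∈ D.L.lattice, ∃ w ∈ periodLattice D.f, z = D.c * w) → 2 ^ 2 ∣ N →
      ¬ (∃ (W' : WeierstrassCurve ℚ) (d : ℤ), W'.IsElliptic ∧ W'.IsGloballyMinimal ∧
        (d = -1 ∨ d = 2 ∨ d = -2) ∧ IsIsogenous W (W'.quadraticTwist (d : ℚ)) ∧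
        ¬ 2 ^ 2 ∣ W'.conductorNorm ℤ) →
      ¬ (2 : ℤ) ∣ D.maninConstant := by
  intro hM hAU hC2 hnf
  suffices key : ∀ (n : ℕ) (W : WeierstrassCurve ℚ) [W.IsElliptic] [W.IsGloballyMinimal] (N : ℕ)
      [NeZero N] (D : ModularParametrizationData W N), N < n →
      (∀ z ∈ D.L.lattice, ∃ w ∈ periodLattice D.f, z = D.c * w) → 2 ^ 2 ∣ N →
      ¬ (∃ (W' : WeierstrassCurve ℚ) (d : ℤ), W'.IsElliptic ∧ W'.IsGloballyMinimal ∧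
        (d = -1 ∨ d = 2 ∨ d = -2) ∧ IsIsogenous W (W'.quadraticTwist (d : ℚ)) ∧
        ¬ 2 ^ 2 ∣ W'.conductorNorm ℤ) →
      ¬ (2 : ℤ) ∣ D.maninConstant by
    intro W _ _ N _ D hopt h4 hmin
    exact key (N + 1) W N D (Nat.lt_succ_self N) hopt h4 hmin
  intro n
  induction n with
  | zero => intro W _ _ N _ D hN; exact absurd hN (Nat.not_lt_zero N)
  | succ n ih =>
    intro W _ _ N _ D hNn hopt h4 hmin
    by_cases hodd : ∃ (W' : WeierstrassCurve ℚ) (q : ℕ), W'.IsElliptic ∧ W'.IsGloballyMinimal ∧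
        q.Prime ∧ q ≠ 2 ∧ q ^ 2 ∣ N ∧
        IsIsogenous W (W'.quadraticTwist (((-1 : ℤ) ^ (q / 2) * q : ℤ) : ℚ)) ∧
        ¬ q ^ 2 ∣ W'.conductorNorm ℤ
    · obtain ⟨W', q, hE', hM', hqp, hq2, hqN, htw, hqN'⟩ := hodd
      haveI := hE'
      haveI := hM'
      haveI : Fact q.Prime := ⟨hqp⟩
      refine maninLocalTwoThree_not_dvd_maninConstant_of_oddUntwist hnf hq2 D hopt hqN htw hqN' ?_
      intro W₁ _ _ N₁ _ D₁ hiso₁ hopt₁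
      have hd0 : ((((-1 : ℤ) ^ (q / 2) * q : ℤ)) : ℚ) ≠ 0 := by
        push_cast
        exact mul_ne_zero (pow_ne_zero _ (by norm_num)) (by exact_mod_cast hqp.ne_zero)
      haveI : (W'.quadraticTwist (((-1 : ℤ) ^ (q / 2) * q : ℤ) : ℚ)).IsElliptic :=
        W'.isElliptic_quadraticTwist hd0
      have hN : N = W.conductorNorm ℤ :=
        IsNewformOf.level_eq_conductorNorm_of_exists_isNewformOf hnf D.isNewformOf
      have hN₁ : N₁ = W'.conductorNorm ℤ := level_eq_conductorNorm_of_isIsogenous hnf D₁ hiso₁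
      have hqNW : q ^ 2 ∣ W.conductorNorm ℤ := hN ▸ hqN
      have hadd : ¬ W.HasGoodReductionAtPrime q ∧ ¬ W.HasMultiplicativeReductionAtPrime q :=
        Summit.BirchSwinnertonDyer.Rank1Residual.ManinAdditive.not_good_and_not_mult_of_sq_dvd_conductorNorm
          W hqNW
      have hN'N : W'.conductorNorm ℤ ∣ W.conductorNorm ℤ :=
        maninLocalTwoThree_conductorNorm_dvd_of_isIsogenous_twist_pStar hnf hq2 htw hqN' hadd
      -- the two places: `v₂` (prime `2 ≠ q`)
      have hv2 : natGenerator ((primesEquiv (R := ℤ)).symm ⟨2, Nat.prime_two⟩) ≠ q := by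
        rw [natGenerator_primesEquiv_symm Nat.prime_two]; exact fun h ↦ hq2 h.symm
      -- `N₁ < N`
      have hlt : N₁ < N := by
        rw [hN₁, hN]
        refine lt_of_le_of_ne (Nat.le_of_dvd (conductorNorm_pos_holds W) hN'N) fun h ↦ hqN' ?_
        rw [h]; exact hqNW
      -- `4 ∣ N₁`
      have h4₁ : 2 ^ 2 ∣ N₁ := by
        have h2W : 2 ≤ (W.conductorNorm ℤ).factorization 2 :=
          (Nat.prime_two.pow_dvd_iff_le_factorization (conductorNorm_pos_holds W).ne').mp (hN ▸ h4)
        rw [hN₁]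
        refine (Nat.prime_two.pow_dvd_iff_le_factorization (conductorNorm_pos_holds W').ne').mpr ?_
        have hf2 := maninLocalTwoThree_conductorExponent_eq_of_isIsogenous_twist_pStar hnf hq2 htw
          ((primesEquiv (R := ℤ)).symm ⟨2, Nat.prime_two⟩) hv2
        have e1 := factorization_conductorNorm_primesEquiv_symm W ⟨2, Nat.prime_two⟩
        have e2 := factorization_conductorNorm_primesEquiv_symm W' ⟨2, Nat.prime_two⟩
        simp only at e1 e2
        rw [e2, ← hf2, ← e1]
        exact h2W
      -- `W₁` is dyadically twist-minimal
      have hmin₁ : ¬ (∃ (V : WeierstrassCurve ℚ) (d : ℤ), V.IsElliptic ∧ V.IsGloballyMinimal ∧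
          (d = -1 ∨ d = 2 ∨ d = -2) ∧ IsIsogenous W₁ (V.quadraticTwist (d : ℚ)) ∧
          ¬ 2 ^ 2 ∣ V.conductorNorm ℤ) := by
        rintro ⟨V, d, hVe, hVm, hd, hisoV, h4V⟩
        haveI := hVe
        haveI := hVm
        have hdne : d ≠ 0 := by rcases hd with rfl | rfl | rfl <;> norm_num
        have hdq : (d : ℚ) ≠ 0 := by exact_mod_cast hdne
        haveI : (V.quadraticTwist (d : ℚ)).IsElliptic := V.isElliptic_quadraticTwist hdq
        haveI : (V.quadraticTwist (((-1 : ℤ) ^ (q / 2) * q : ℤ) : ℚ)).IsElliptic :=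
          V.isElliptic_quadraticTwist hd0
        obtain ⟨C, hCmin⟩ :=
          hasGlobalMinimalModel_rat_holds (V.quadraticTwist (((-1 : ℤ) ^ (q / 2) * q : ℤ) : ℚ))
        haveI := hCmin
        apply hmin
        refine ⟨C • V.quadraticTwist (((-1 : ℤ) ^ (q / 2) * q : ℤ) : ℚ), d, inferInstance, hCmin,
          hd, ?_, ?_⟩
        · -- `W ∼ (C • V ⊗ χ_{q*}) ⊗ χ_d`
          have h1 : IsIsogenous W' (V.quadraticTwist (d : ℚ)) := hiso₁.trans' hisoV
          have h2 : IsIsogenous (W'.quadraticTwist (((-1 : ℤ) ^ (q / 2) * q : ℤ) : ℚ))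
              ((V.quadraticTwist (d : ℚ)).quadraticTwist (((-1 : ℤ) ^ (q / 2) * q : ℤ) : ℚ)) :=
            h1.quadraticTwist hd0
          rw [quadraticTwist_quadraticTwist, mul_comm ((d : ℤ) : ℚ) ((((-1 : ℤ) ^ (q / 2) * q : ℤ)) : ℚ),
            ← quadraticTwist_quadraticTwist] at h2
          have h3 : IsIsogenous
              ((V.quadraticTwist (((-1 : ℤ) ^ (q / 2) * q : ℤ) : ℚ)).quadraticTwist (d : ℚ))
              ((C • V.quadraticTwist (((-1 : ℤ) ^ (q / 2) * q : ℤ) : ℚ)).quadraticTwist (d : ℚ)) := by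
            rw [quadraticTwist_smul]; exact isIsogenous_smul _ _
          exact (htw.trans' h2).trans' h3
        · -- `4 ∤ N(C • V ⊗ χ_{q*})`: `f₂(V ⊗ χ_{q*}) = f₂(V) ≤ 1`
          rw [conductorNorm_smul_rat]
          intro h4V₂
          apply h4V
          have hC1 : (1 : VariableChange ℚ) • V.quadraticTwist ((-1 : ℚ) ^ (q / 2) * q) =
              V.quadraticTwist (((-1 : ℤ) ^ (q / 2) * q : ℤ) : ℚ) := by
            rw [one_smul]; push_cast; rfl
          have hf := Summit.BirchSwinnertonDyer.Rank1Residual.Additive.conductorExponent_eq_of_twist_pStar_of_ne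
            q hq2 V _ 1 hC1 ((primesEquiv (R := ℤ)).symm ⟨2, Nat.prime_two⟩) hv2
          have e1 := factorization_conductorNorm_primesEquiv_symm V ⟨2, Nat.prime_two⟩
          have e2 := factorization_conductorNorm_primesEquiv_symm
            (V.quadraticTwist (((-1 : ℤ) ^ (q / 2) * q : ℤ) : ℚ)) ⟨2, Nat.prime_two⟩
          simp only at e1 e2
          refine (Nat.prime_two.pow_dvd_iff_le_factorization (conductorNorm_pos_holds V).ne').mpr ?_
          rw [e1, ← hf, ← e2]
          exact (Nat.prime_two.pow_dvd_iff_le_factorization (conductorNorm_pos_holds _).ne').mp h4V₂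
      exact ih W₁ N₁ D₁ (by omega) hopt₁ h4₁ hmin₁
    · exact H hM hAU hC2 hnf W D hopt h4 hmin hodd

end Summit.BirchSwinnertonDyer.BirchSwinnertonDyer.Theorems

end
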